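import Mathlib
import Literature.Computability.AlgebraicComplexity.StandardFamilies
import Literature.Computability.AlgebraicComplexity.StandardFamiliesProofs
import Summits.ValiantsHypothesis.ValiantsHypothesis.Theorems.ElementaryWordLengthWordLengthQPStubIndgLetters
import Summits.ValiantsHypothesis.ValiantsHypothesis.Theorems.ElementaryWordLengthWordLengthQPStubLetterMachine
import Summits.ValiantsHypothesis.ValiantsHypothesis.Theorems.ElementaryWordLengthWordLengthQPStubContinuantTop
import Summits.ValiantsHypothesis.ValiantsHypothesis.Theorems.ElementaryWordLengthWordLengthQPRung0Nonuniversal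
import Summits.ValiantsHypothesis.ValiantsHypothesis.Theorems.ElementaryWordLengthWordLengthQPStubSigmaPiSigmaLowDegreePerm

/-!
# Crux `WordLengthQP` (stmt-ValiantsHypothesis-6623), line `Sketch` (eps-order-ladder) —
stub `stub_rungOne_E2_noSuperDegree` (seat c4): RUNG 1 WITHOUT TOP CANCELLATION IS EXPONENTIAL

Rung `q = 1` of the ε-order ladder in its tangent normal form (`rungOne_normal_form`, p119541):
`f = Σ_{t<L} (A_{<t} · B_t · A_{>t})₀₀` over ONE exact S-affine skeleton `A₁ ⋯ A_L`.  For a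
unit-determinant (E₂) skeleton every prefix entry `(A_{<t})₀ᵢ` and suffix entry `(A_{>t})ⱼ₀` is an
entry of an E₂-walk, whose top homogeneous part is a non-zero constant times a product of linear
forms (`stub_indgLetters`, `stub_letterMachine`, `stub_continuantTop` — the rung-0 machinery;
`nsd_topIsProd`).  Hence, if none of the `4L` path bundles
`(A_{<t})₀ᵢ · (B_t)ᵢⱼ · (A_{>t})ⱼ₀` has degree `> n` (no cancellation of super-degree tops), the
degree-`n` layer of `f` is a homogeneous `ΣΠ^{[n]}Σ` expression with at most `4L` terms, and
`f = per_n` forces `4L ≥ binom(n,k)` for all `k ≤ n` by Nisan–Wigderson's partial-derivative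
bound (`stub_sigmaPiSigma_lowDegree_perm`, p123584; `flatteningRank_perPoly`).  This is the typed
statement that the whole difficulty of rung 1 sits in the cancellation of super-degree tops along
one shared E₂-walk (the universality construction `rungOne_universal` uses terms of degree up to
twice the target's).

## References
* [NisanWigderson1996] N. Nisan, A. Wigderson, *Lower bounds on arithmetic circuits via partial
  derivatives*, Comput. Complexity 6 (1996/97), Thm. 3.2.
* [AllenderWang2016] E. Allender, F. Wang, *On the power of algebraic branching programs of
  width two*, Comput. Complexity 25 (2016) (the E₂ normal form behind `stub_letterMachine`).
-/

-- `Summit.ValiantsHypothesis.ValiantsHypothesis.…` is the tree's mandated single-conjunct layout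
-- (Sub = Summit), so the duplicated namespace component is intended.
set_option linter.dupNamespace false

noncomputable section

open MvPolynomial

namespace Summit.ValiantsHypothesis.ValiantsHypothesis.Cruxes.WordLengthQP.EpsOrderLadder

open Literature.Computability.AlgebraicComplexity

/-! ### Tops of E₂-walk entries are products of linear forms -/

/-- **Tops of E₂-walk entries** (AW16 normal form, S-model; glued from `stub_indgLetters`,
`stub_letterMachine`, `stub_continuantTop` exactly as `rung0_lemmaB`, but keeping the sharp
conclusion): for unit-determinant S-affine `ms` and constant boundary matrices `A`, `B`, the
polynomial `f = (A · ∏ ms · B)₀₀` is `0` or its top homogeneous part is a non-zero constant times a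
product of non-zero linear forms. -/
theorem nsd_topIsProd {σ : Type} [Fintype σ] [DecidableEq σ]
    (ms : List (Matrix (Fin 2) (Fin 2) (MvPolynomial σ ℂ))) (A B : Matrix (Fin 2) (Fin 2) ℂ)
    (hms : ∀ m ∈ ms, (∀ i j : Fin 2, (∃ b : ℂ, m i j = MvPolynomial.C b) ∨
        (∃ (a b : ℂ) (v : σ), m i j = MvPolynomial.C a * MvPolynomial.X v + MvPolynomial.C b)) ∧
      ∃ d : ℂ, d ≠ 0 ∧ m.det = MvPolynomial.C d)
    (f : MvPolynomial σ ℂ)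
    (hf : f = ((A.map (MvPolynomial.C (σ := σ) (R := ℂ))) * ms.prod *
      (B.map (MvPolynomial.C (σ := σ) (R := ℂ)))) 0 0) :
    f = 0 ∨ ∃ (κ : ℂ) (lins : List (MvPolynomial σ ℂ)), κ ≠ 0 ∧
      (∀ l ∈ lins, l.IsHomogeneous 1 ∧ l ≠ 0) ∧
      MvPolynomial.homogeneousComponent f.totalDegree f = MvPolynomial.C κ * lins.prod := by
  classical
  -- (1) expand every matrix into letters
  have hws : ∃ ws : List (Matrix (Fin 2) (Fin 2) (MvPolynomial σ ℂ)),
      (∀ x ∈ ws, (∃ ℓ : MvPolynomial σ ℂ, ℓ.totalDegree ≤ 1 ∧ x = !![1, ℓ; 0, 1]) ∨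
        x = !![0, 1; 1, 0] ∨
        (∃ d₁ d₂ : ℂ, d₁ ≠ 0 ∧ d₂ ≠ 0 ∧
          x = !![MvPolynomial.C d₁, 0; 0, MvPolynomial.C d₂])) ∧
      ws.prod = ms.prod := by
    clear hf
    induction ms with
    | nil => exact ⟨[], by simp, by simp⟩
    | cons m ms ih =>
      obtain ⟨ws, hws, hprod⟩ := ih (fun m' hm' => hms m' (by simp [hm']))
      obtain ⟨ws₀, hws₀, hprod₀⟩ := stub_indgLetters m (hms m (by simp)).1 (hms m (by simp)).2
      refine ⟨ws₀ ++ ws, fun x hx => ?_, by simp [hprod, hprod₀]⟩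
      rcases List.mem_append.1 hx with h | h
      · exact hws₀ x h
      · exact hws x h
  obtain ⟨ws, hwsL, hwsprod⟩ := hws
  -- (2) the row vector `A 0`; if it vanishes, `f = 0`
  by_cases hr : (fun k => A 0 k) = 0
  · left
    rw [hf, Matrix.mul_apply]
    refine Finset.sum_eq_zero fun j _ => ?_
    rw [Matrix.mul_apply, Finset.sum_eq_zero, zero_mul]
    intro k _
    have : A 0 k = 0 := congrFun hr k
    simp [Matrix.map_apply, this]
  -- (3) normal form of the row vector times the letter word
  obtain ⟨ls, ε, d₁, d₂, hd₁, hd₂, hdeg, hint, hvec⟩ :=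
    stub_letterMachine ws hwsL (fun k => A 0 k) hr
  set W₀ : Matrix (Fin 2) (Fin 2) ℂ := (!![0, 1; 1, 0] : Matrix (Fin 2) (Fin 2) ℂ) ^ ε * !![d₁, 0; 0, d₂]
    with hW₀
  set c : Fin 2 → ℂ := fun k => ∑ j : Fin 2, W₀ k j * B j 0 with hc
  have hrow : ∀ j : Fin 2, ((A.map (MvPolynomial.C (σ := σ) (R := ℂ))) * ms.prod) 0 j =
      Matrix.vecMul (fun i => MvPolynomial.C (A 0 i)) ws.prod j := by
    intro j
    rw [hwsprod]
    simp [Matrix.mul_apply, Matrix.vecMul, dotProduct, Matrix.map_apply]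
  have hf' : f = ∑ k : Fin 2,
      (ls.map (fun L => (!![L, 1; 1, 0] : Matrix (Fin 2) (Fin 2) (MvPolynomial σ ℂ)))).prod 0 k *
        MvPolynomial.C (c k) := by
    rw [hf, Matrix.mul_apply]
    simp_rw [hrow, hvec]
    rw [Matrix.mul_assoc, rung0_wPow_mul_diag_eq_map, ← hW₀]
    simp only [Matrix.vecMul, dotProduct, Fin.sum_univ_two, Matrix.cons_val_zero,
      Matrix.cons_val_one, one_mul, zero_mul, add_zero,
      Matrix.mul_apply, Matrix.map_apply, hc, map_add, map_mul]
    ring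
  exact stub_continuantTop ls hdeg hint c f hf'

/-- A product of non-zero linear forms is non-zero and homogeneous of degree the number of
factors. [folklore] -/
theorem nsd_prod_lins {σ : Type} (ls : List (MvPolynomial σ ℂ))
    (h : ∀ l ∈ ls, l.IsHomogeneous 1 ∧ l ≠ 0) :
    ls.prod.IsHomogeneous ls.length ∧ ls.prod ≠ 0 := by
  induction ls with
  | nil => exact ⟨by simpa using isHomogeneous_one σ ℂ, one_ne_zero⟩
  | cons l ls ih =>
    have hl := h l (by simp)
    have ht := ih (fun l' hl' => h l' (by simp [hl']))
    refine ⟨?_, ?_⟩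
    · simpa [List.prod_cons, List.length_cons, add_comm] using hl.1.mul ht.1
    · simpa [List.prod_cons] using mul_ne_zero hl.2 ht.2

/-- The top homogeneous part of a non-zero polynomial is non-zero. [folklore] -/
theorem nsd_top_ne_zero {σ : Type} {f : MvPolynomial σ ℂ} (hf : f ≠ 0) :
    MvPolynomial.homogeneousComponent f.totalDegree f ≠ 0 := by
  classical
  obtain ⟨e, he, hedeg⟩ := Finset.exists_mem_eq_sup f.support
    (Finset.nonempty_of_ne_empty (by rwa [Ne, support_eq_empty])) (fun s => s.sum fun _ n => n)
  intro h0
  have := congrArg (coeff e) h0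
  rw [coeff_homogeneousComponent, coeff_zero, if_pos] at this
  · exact (mem_support_iff.1 he) this
  · rw [totalDegree, hedeg, Finsupp.degree_apply]
    rfl

/-- If the top part of `f ≠ 0` is `κ · ∏ lins` with non-zero linear forms `lins`, then
`deg f = #lins`. [folklore] -/
theorem nsd_len_eq_totalDegree {σ : Type} {f : MvPolynomial σ ℂ} (hf : f ≠ 0) {κ : ℂ}
    {lins : List (MvPolynomial σ ℂ)} (hlins : ∀ l ∈ lins, l.IsHomogeneous 1 ∧ l ≠ 0)
    (htop : MvPolynomial.homogeneousComponent f.totalDegree f = MvPolynomial.C κ * lins.prod) :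
    lins.length = f.totalDegree := by
  have h1 : (MvPolynomial.homogeneousComponent f.totalDegree f).IsHomogeneous f.totalDegree :=
    homogeneousComponent_isHomogeneous _ _
  have h2 : (MvPolynomial.homogeneousComponent f.totalDegree f).IsHomogeneous lins.length := by
    rw [htop]
    simpa using (isHomogeneous_C σ κ).mul (nsd_prod_lins lins hlins).1
  exact (h1.inj_right h2 (nsd_top_ne_zero hf)).symm

/-- A "top representation": the degree-`deg g` part of `g` is a constant times a product of
`deg g` polynomials of degree `≤ 1`. [folklore] -/
theorem nsd_topRepr_of_topIsProd {σ : Type} {g : MvPolynomial σ ℂ}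
    (h : g = 0 ∨ ∃ (κ : ℂ) (lins : List (MvPolynomial σ ℂ)), κ ≠ 0 ∧
      (∀ l ∈ lins, l.IsHomogeneous 1 ∧ l ≠ 0) ∧
      MvPolynomial.homogeneousComponent g.totalDegree g = MvPolynomial.C κ * lins.prod) :
    ∃ (κ : ℂ) (L : List (MvPolynomial σ ℂ)), (∀ l ∈ L, l.totalDegree ≤ 1) ∧
      L.length = g.totalDegree ∧
      MvPolynomial.homogeneousComponent g.totalDegree g = MvPolynomial.C κ * L.prod := by
  rcases h with rfl | ⟨κ, lins, -, hlins, htop⟩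
  · exact ⟨0, [], by simp, by simp, by simp⟩
  · by_cases hg : g = 0
    · subst hg
      exact ⟨0, [], by simp, by simp, by simp⟩
    refine ⟨κ, lins, fun l hl => ?_, nsd_len_eq_totalDegree hg hlins htop, htop⟩
    obtain ⟨hhom, hne⟩ := hlins l hl
    exact (hhom.totalDegree hne).le

/-- Top representation of an S-affine letter entry. [folklore] -/
theorem nsd_topRepr_sAffine {σ : Type} {b : MvPolynomial σ ℂ}
    (hb : (∃ b₀ : ℂ, b = MvPolynomial.C b₀) ∨
      (∃ (a b₀ : ℂ) (v : σ), b = MvPolynomial.C a * MvPolynomial.X v + MvPolynomial.C b₀)) :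
    ∃ (κ : ℂ) (L : List (MvPolynomial σ ℂ)), (∀ l ∈ L, l.totalDegree ≤ 1) ∧
      L.length = b.totalDegree ∧
      MvPolynomial.homogeneousComponent b.totalDegree b = MvPolynomial.C κ * L.prod := by
  classical
  -- reduce the affine case with `a = 0` to the constant case
  have key : ∀ b₀ : ℂ, ∃ (κ : ℂ) (L : List (MvPolynomial σ ℂ)), (∀ l ∈ L, l.totalDegree ≤ 1) ∧
      L.length = (MvPolynomial.C b₀ : MvPolynomial σ ℂ).totalDegree ∧
      MvPolynomial.homogeneousComponent (MvPolynomial.C b₀ : MvPolynomial σ ℂ).totalDegree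
        (MvPolynomial.C b₀) = MvPolynomial.C κ * L.prod := by
    intro b₀
    refine ⟨b₀, [], by simp, by simp, ?_⟩
    simp [homogeneousComponent_zero]
  rcases hb with ⟨b₀, rfl⟩ | ⟨a, b₀, v, rfl⟩
  · exact key b₀
  · by_cases ha : a = 0
    · simp only [ha, C_0, zero_mul, zero_add]
      exact key b₀
    · have hX : (MvPolynomial.C a * MvPolynomial.X v : MvPolynomial σ ℂ).IsHomogeneous 1 := by
        simpa using (isHomogeneous_C σ a).mul (isHomogeneous_X ℂ v)
      have hXne : (MvPolynomial.C a * MvPolynomial.X v : MvPolynomial σ ℂ) ≠ 0 :=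
        mul_ne_zero (C_ne_zero.2 ha) (X_ne_zero v)
      have hdeg1 : (MvPolynomial.C a * MvPolynomial.X v : MvPolynomial σ ℂ).totalDegree = 1 :=
        hX.totalDegree hXne
      have hdeg : (MvPolynomial.C a * MvPolynomial.X v + MvPolynomial.C b₀ :
          MvPolynomial σ ℂ).totalDegree = 1 := by
        have := (continuantTop_top_add (p := MvPolynomial.C a * MvPolynomial.X v)
          (q := (MvPolynomial.C b₀ : MvPolynomial σ ℂ)) (Or.inr (by simp [hdeg1]))).1
        rw [this, hdeg1]
      refine ⟨a, [MvPolynomial.X v], by simp [totalDegree_X], by simp [hdeg], ?_⟩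
      have h1 : homogeneousComponent 1 (MvPolynomial.C a * MvPolynomial.X v : MvPolynomial σ ℂ) =
          MvPolynomial.C a * MvPolynomial.X v := by
        rw [homogeneousComponent_of_mem ((mem_homogeneousSubmodule 1 _).2 hX), if_pos rfl]
      have h2 : homogeneousComponent 1 (MvPolynomial.C b₀ : MvPolynomial σ ℂ) = 0 := by
        rw [homogeneousComponent_of_mem ((mem_homogeneousSubmodule 0 _).2 (isHomogeneous_C σ b₀)),
          if_neg (by norm_num)]
      rw [hdeg, map_add, h1, h2, add_zero]
      simp

/-- **One path bundle.**  If `p`, `q` have top representations (tops of E₂-walk entries), `b`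
is an S-affine entry and `deg (p b q) ≤ n`, then the degree-`n` layer of `p · b · q` is a constant
times a product of at most `n` polynomials of degree `≤ 1`. [folklore] -/
theorem nsd_term_repr {σ : Type} (n : ℕ) {p b q : MvPolynomial σ ℂ}
    (hp : ∃ (κ : ℂ) (L : List (MvPolynomial σ ℂ)), (∀ l ∈ L, l.totalDegree ≤ 1) ∧
      L.length = p.totalDegree ∧
      MvPolynomial.homogeneousComponent p.totalDegree p = MvPolynomial.C κ * L.prod)
    (hb : ∃ (κ : ℂ) (L : List (MvPolynomial σ ℂ)), (∀ l ∈ L, l.totalDegree ≤ 1) ∧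
      L.length = b.totalDegree ∧
      MvPolynomial.homogeneousComponent b.totalDegree b = MvPolynomial.C κ * L.prod)
    (hq : ∃ (κ : ℂ) (L : List (MvPolynomial σ ℂ)), (∀ l ∈ L, l.totalDegree ≤ 1) ∧
      L.length = q.totalDegree ∧
      MvPolynomial.homogeneousComponent q.totalDegree q = MvPolynomial.C κ * L.prod)
    (hdeg : (p * b * q).totalDegree ≤ n) :
    ∃ (κ : ℂ) (L : List (MvPolynomial σ ℂ)), (∀ l ∈ L, l.totalDegree ≤ 1) ∧ L.length ≤ n ∧
      MvPolynomial.homogeneousComponent n (p * b * q) = MvPolynomial.C κ * L.prod := by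
  rcases (Nat.lt_or_eq_of_le hdeg) with hlt | heq
  · exact ⟨0, [], by simp, by simp, by rw [homogeneousComponent_eq_zero _ _ hlt]; simp⟩
  by_cases hp0 : p = 0
  · exact ⟨0, [], by simp, by simp, by simp [hp0]⟩
  by_cases hb0 : b = 0
  · exact ⟨0, [], by simp, by simp, by simp [hb0]⟩
  by_cases hq0 : q = 0
  · exact ⟨0, [], by simp, by simp, by simp [hq0]⟩
  obtain ⟨κp, Lp, hLp, hlenp, htp⟩ := hp
  obtain ⟨κb, Lb, hLb, hlenb, htb⟩ := hb
  obtain ⟨κq, Lq, hLq, hlenq, htq⟩ := hq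
  obtain ⟨hd1, ht1⟩ := continuantTop_top_mul hp0 hb0
  obtain ⟨hd2, ht2⟩ := continuantTop_top_mul (mul_ne_zero hp0 hb0) hq0
  refine ⟨κp * κb * κq, Lp ++ Lb ++ Lq, fun l hl => ?_, ?_, ?_⟩
  · simp only [List.mem_append] at hl
    rcases hl with (hl | hl) | hl
    · exact hLp l hl
    · exact hLb l hl
    · exact hLq l hl
  · simp only [List.length_append]
    omega
  · rw [← heq, ht2, ht1, htp, htb, htq]
    simp only [List.prod_append, map_mul]
    ring

/-! ### The theorem -/

/-- **stub_rungOne_E2_noSuperDegree** (seat c4, registered; the lead's): RUNG 1 WITHOUT TOP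
CANCELLATION IS EXPONENTIAL. In the tangent normal form `f = Σ_t (A_{<t} B_t A_{>t})₀₀` of an
order-1 program (`rungOne_normal_form`) with a unit-determinant (E₂) S-affine skeleton, if none of
the `4L` path bundles `(A_{<t})₀ᵢ · (B_t)ᵢⱼ · (A_{>t})ⱼ₀` has degree `> n`, then `f = per_n` forces
`4 L ≥ binom(n, k)` for all `k ≤ n` (so `L ≥ 2ⁿ / (4(n+1))` at `k = ⌊n/2⌋`): tops of E₂-walk
entries are single products of linear forms (`stub_letterMachine`, `stub_continuantTop`), so the
degree-`n` layer of the right-hand side is a homogeneous `ΣΠ^{[n]}Σ` expression with `≤ 4L` terms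
and `stub_sigmaPiSigma_lowDegree_perm` applies. The skeleton condition `(∏ A)₀₀ = 0` is not even
used: what the bound charges is the absence of super-degree cancellation, which the universality
construction `rungOne_universal` (terms of degree up to twice the target's) relies on. -/
theorem stub_rungOne_E2_noSuperDegree (n : ℕ)
    (As Bs : List (Matrix (Fin 2) (Fin 2) (MvPolynomial (Fin n × Fin n) ℂ)))
    (hlen : Bs.length = As.length)
    (hA : ∀ A ∈ As, (∀ i j : Fin 2, (∃ b : ℂ, A i j = MvPolynomial.C b) ∨
        (∃ (a b : ℂ) (v : Fin n × Fin n),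
          A i j = MvPolynomial.C a * MvPolynomial.X v + MvPolynomial.C b)) ∧
      ∃ d : ℂ, d ≠ 0 ∧ A.det = MvPolynomial.C d)
    (hB : ∀ B ∈ Bs, ∀ i j : Fin 2, (∃ b : ℂ, B i j = MvPolynomial.C b) ∨
        (∃ (a b : ℂ) (v : Fin n × Fin n),
          B i j = MvPolynomial.C a * MvPolynomial.X v + MvPolynomial.C b))
    (hdeg : ∀ t < As.length, ∀ i j : Fin 2,
      ((As.take t).prod 0 i * Bs.getD t 0 i j * (As.drop (t + 1)).prod j 0).totalDegree ≤ n)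
    (hf : Literature.Computability.AlgebraicComplexity.perPoly (Fin n) ℂ =
      (∑ t ∈ Finset.range As.length,
        (As.take t).prod * Bs.getD t 0 * (As.drop (t + 1)).prod) 0 0)
    (k : ℕ) (hk : k ≤ n) :
    n.choose k ≤ 4 * As.length := by
  classical
  -- the `4L` path bundles
  set term : ℕ × Fin 2 × Fin 2 → MvPolynomial (Fin n × Fin n) ℂ := fun x =>
    (As.take x.1).prod 0 x.2.1 * Bs.getD x.1 0 x.2.1 x.2.2 * (As.drop (x.1 + 1)).prod x.2.2 0
    with hterm
  set s : Finset (ℕ × Fin 2 × Fin 2) := (Finset.range As.length) ×ˢ Finset.univ with hs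
  have hcard : s.card = 4 * As.length := by
    rw [hs, Finset.card_product, Finset.card_range, Finset.card_univ, Fintype.card_prod,
      Fintype.card_fin]
    ring
  -- (1) `per_n = Σ_{(t,i,j)} term`
  have hsum : perPoly (Fin n) ℂ = ∑ x ∈ s, term x := by
    rw [hf, Matrix.sum_apply, hs, Finset.sum_product]
    refine Finset.sum_congr rfl fun t _ => ?_
    rw [Matrix.mul_apply, Fintype.sum_prod_type]
    rw [Finset.sum_comm]
    refine Finset.sum_congr rfl fun j _ => ?_
    rw [Matrix.mul_apply, Finset.sum_mul]
  -- (2) top representations of the three factors of every bundle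
  have hpre : ∀ (t : ℕ) (i : Fin 2), ∃ (κ : ℂ) (L : List (MvPolynomial (Fin n × Fin n) ℂ)),
      (∀ l ∈ L, l.totalDegree ≤ 1) ∧ L.length = ((As.take t).prod 0 i).totalDegree ∧
      homogeneousComponent ((As.take t).prod 0 i).totalDegree ((As.take t).prod 0 i) =
        C κ * L.prod := by
    intro t i
    refine nsd_topRepr_of_topIsProd (nsd_topIsProd (As.take t) 1 (Matrix.single i 0 1)
      (fun m hm => hA m (List.mem_of_mem_take hm)) _ ?_)
    have h1 : ((1 : Matrix (Fin 2) (Fin 2) ℂ).map (MvPolynomial.C (σ := Fin n × Fin n) (R := ℂ)))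
        = 1 := Matrix.map_one _ (map_zero _) (map_one _)
    rw [h1, one_mul, Matrix.mul_apply, Fin.sum_univ_two]
    fin_cases i <;> simp [Matrix.map_apply, Matrix.single]
  have hsuf : ∀ (t : ℕ) (j : Fin 2), ∃ (κ : ℂ) (L : List (MvPolynomial (Fin n × Fin n) ℂ)),
      (∀ l ∈ L, l.totalDegree ≤ 1) ∧ L.length = ((As.drop (t + 1)).prod j 0).totalDegree ∧
      homogeneousComponent ((As.drop (t + 1)).prod j 0).totalDegree ((As.drop (t + 1)).prod j 0) =
        C κ * L.prod := by
    intro t j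
    refine nsd_topRepr_of_topIsProd (nsd_topIsProd (As.drop (t + 1)) (Matrix.single 0 j 1) 1
      (fun m hm => hA m (List.mem_of_mem_drop hm)) _ ?_)
    have h1 : ((1 : Matrix (Fin 2) (Fin 2) ℂ).map (MvPolynomial.C (σ := Fin n × Fin n) (R := ℂ)))
        = 1 := Matrix.map_one _ (map_zero _) (map_one _)
    rw [h1, mul_one, Matrix.mul_apply, Fin.sum_univ_two]
    fin_cases j <;> simp [Matrix.map_apply, Matrix.single]
  have hmid : ∀ (t : ℕ) (i j : Fin 2), ∃ (κ : ℂ) (L : List (MvPolynomial (Fin n × Fin n) ℂ)),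
      (∀ l ∈ L, l.totalDegree ≤ 1) ∧ L.length = (Bs.getD t 0 i j).totalDegree ∧
      homogeneousComponent (Bs.getD t 0 i j).totalDegree (Bs.getD t 0 i j) = C κ * L.prod := by
    intro t i j
    refine nsd_topRepr_sAffine ?_
    rw [List.getD_eq_getElem?_getD]
    by_cases ht : t < Bs.length
    · rw [List.getElem?_eq_getElem ht, Option.getD_some]
      exact hB _ (List.getElem_mem ht) i j
    · rw [List.getElem?_eq_none (by omega), Option.getD_none]
      exact Or.inl ⟨0, by simp⟩
  -- (3) the degree-`n` layer of every bundle
  have hrepr : ∀ x ∈ s, ∃ (κ : ℂ) (L : List (MvPolynomial (Fin n × Fin n) ℂ)),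
      (∀ l ∈ L, l.totalDegree ≤ 1) ∧ L.length ≤ n ∧
      homogeneousComponent n (term x) = C κ * L.prod := by
    intro x hx
    have ht : x.1 < As.length := by
      rw [hs, Finset.mem_product, Finset.mem_range] at hx
      exact hx.1
    exact nsd_term_repr n (hpre x.1 x.2.1) (hmid x.1 x.2.1 x.2.2) (hsuf x.1 x.2.2)
      (hdeg x.1 ht x.2.1 x.2.2)
  choose! κ L hL hLn hLtop using hrepr
  -- (4) `per_n` is its own degree-`n` layer
  have hper : perPoly (Fin n) ℂ = ∑ x ∈ s, C (κ x) * (L x).prod := by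
    have hhom : (perPoly (Fin n) ℂ).IsHomogeneous n := by
      simpa using perPoly_isHomogeneous (n := Fin n) (k := ℂ)
    calc perPoly (Fin n) ℂ = homogeneousComponent n (perPoly (Fin n) ℂ) := by
          rw [homogeneousComponent_of_mem hhom, if_pos rfl]
      _ = ∑ x ∈ s, homogeneousComponent n (term x) := by rw [hsum, map_sum]
      _ = ∑ x ∈ s, C (κ x) * (L x).prod := Finset.sum_congr rfl fun x hx => hLtop x hx
  -- (5) Nisan–Wigderson
  have := stub_sigmaPiSigma_lowDegree_perm n s κ L hL hLn hper k hk
  rwa [hcard] at this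

end Summit.ValiantsHypothesis.ValiantsHypothesis.Cruxes.WordLengthQP.EpsOrderLadder
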